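import Mathlib.Analysis.Calculus.InverseFunctionTheorem.ContDiff
import Literature.Topology.FourManifolds.FramedTubularNbhd
import Literature.Topology.FourManifolds.NormalFrameTransport
import Literature.Topology.FourManifolds.SliceDiscConicalFramingPrelim
import Summits.SmoothPoincare4.SmoothPoincare4.Theorems.DottedCircleRasmussenDcrGapHelperFriendsCarrierVkBandDisc
import Summits.SmoothPoincare4.SmoothPoincare4.Theorems.DottedCircleRasmussenDcrGapHelperFriendsCarrierExterior

/-!
# Helper `helper_friendsCarrier_Vk_partB_tubeLemmas` (piece of the registered stub
`helper_friendsCarrier_Vk_partB`, line `mk_friends`, skeleton v8) for crux `DcrGap`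
(item stmt-SmoothPoincare4-16128, route route-SmoothPoincare4-DottedCircleRasmussen)

**Generic estimates for a tube `G₀ : ℝ² × ℝ² → ℝ⁴` around its zero section**, the part of the `k = 0`
template `SliceDiscConicalTube.lean` (`exists_injOn`, `exists_fderiv_mem_range`, `exists_norm_lt`) that
does not depend on the formula of the tube, restated for a bare map which is `C^∞` on an open set
containing a compact sub-disc `‖x‖ ≤ R'` of the zero section:

* `exists_injOn_tube`: injective zero section + invertible differential along it ⟹ injective on a
  thin tube `‖x‖ ≤ R'`, `‖w‖ < η` (`exists_injOn_prod_ball` of `FramedTubularNbhd.lean` and the inverse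
  function theorem);
* `exists_fderiv_equiv_tube`: invertible differential along the zero section ⟹ on a thin tube
  (invertibility is open, tube lemma);
* `exists_notMem_tube`: zero section off the closed set `D_k` (`isClosed_modelHandlebody` of
  `…HelperFriendsCarrierExterior`) ⟹ thin tube off `D_k`;
* `exists_level_gap`: a compact set off `D_k` keeps a definite level gap above `M_k` off the poles
  (Cantor's intersection theorem, as in `…VkBandDisc`) — used to separate the deep tube from the thin
  collar shell `Φ((0, s₀) × M_k)`;
* the calculus of the blend `A + χ(‖x‖)(C - A)` along the zero section and the passage between
  transversality and linear independence of four vectors.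

No definitions, no named facts, no `sorry`.
-/

-- the prescribed namespace `Summit.<P>.<Sub>.…` duplicates `SmoothPoincare4` (P = Sub)
set_option linter.dupNamespace false
set_option linter.style.longLine false

noncomputable section

open scoped Manifold ContDiff Topology
open Set Function Metric Filter
open Literature.Topology.FourManifolds Literature.Topology.FourManifolds.MMSW

namespace Summit.SmoothPoincare4.SmoothPoincare4.Theorems.DcrGap.MkFriends

namespace FriendsCarrierVk

/-! ## Thin tubes around a compact piece of the zero section -/

set_option maxHeartbeats 800000 in
/-- **Injectivity on a thin tube.**  A map `G₀`, `C^∞` on an open set containing `B̄(0, R') × ℝ²`, whose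
zero section is injective on `B̄(0, R')` and whose differential is invertible along it, is injective on
`B̄(0, R') × B(0, η)` for some `η > 0`. [folklore] -/
theorem exists_injOn_tube {G₀ : (EuclideanSpace ℝ (Fin 2)) × (EuclideanSpace ℝ (Fin 2)) → EuclideanSpace ℝ (Fin 4)}
    {Ω : Set ((EuclideanSpace ℝ (Fin 2)) × (EuclideanSpace ℝ (Fin 2)))} {R' : ℝ} (hΩ : IsOpen Ω)
    (hG : ContDiffOn ℝ ∞ G₀ Ω) (hsub : closedBall (0 : EuclideanSpace ℝ (Fin 2)) R' ×ˢ (univ : Set (EuclideanSpace ℝ (Fin 2))) ⊆ Ω)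
    (hinj : InjOn (fun x => G₀ (x, 0)) (closedBall 0 R'))
    (hder : ∀ x ∈ closedBall (0 : EuclideanSpace ℝ (Fin 2)) R',
      ∃ e : ((EuclideanSpace ℝ (Fin 2)) × (EuclideanSpace ℝ (Fin 2))) ≃L[ℝ] EuclideanSpace ℝ (Fin 4),
        HasFDerivAt G₀ (e : _ →L[ℝ] _) (x, 0)) :
    ∃ η > 0, InjOn G₀ (closedBall 0 R' ×ˢ ball 0 η) := by
  haveI : CompactSpace (closedBall (0 : EuclideanSpace ℝ (Fin 2)) R') := isCompact_iff_compactSpace.1 (isCompact_closedBall _ _)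
  let ι : (closedBall (0 : EuclideanSpace ℝ (Fin 2)) R') × (EuclideanSpace ℝ (Fin 2)) → (EuclideanSpace ℝ (Fin 2)) × (EuclideanSpace ℝ (Fin 2)) :=
    fun p => ((p.1 : EuclideanSpace ℝ (Fin 2)), p.2)
  have hι : Continuous ι := (continuous_subtype_val.comp continuous_fst).prodMk continuous_snd
  have hιinj : Injective ι := by
    rintro ⟨a, v⟩ ⟨b, v'⟩ hab
    simp only [ι, Prod.mk.injEq] at hab
    exact Prod.ext (Subtype.ext hab.1) hab.2
  have hιmem : ∀ p, ι p ∈ Ω := fun p => hsub ⟨p.1.2, mem_univ _⟩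
  set G : (closedBall (0 : EuclideanSpace ℝ (Fin 2)) R') × (EuclideanSpace ℝ (Fin 2)) → EuclideanSpace ℝ (Fin 4) := G₀ ∘ ι with hGdef
  have hGc : Continuous G := hG.continuousOn.comp_continuous hι hιmem
  have h0 : Injective fun p : closedBall (0 : EuclideanSpace ℝ (Fin 2)) R' => G (p, 0) := by
    intro p p' h
    have h' : G₀ ((p : EuclideanSpace ℝ (Fin 2)), 0) = G₀ ((p' : EuclideanSpace ℝ (Fin 2)), 0) := h
    exact Subtype.ext (hinj p.2 p'.2 h')
  have hloc : ∀ p : closedBall (0 : EuclideanSpace ℝ (Fin 2)) R', ∃ U ∈ 𝓝 (p, (0 : EuclideanSpace ℝ (Fin 2))), InjOn G U := by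
    intro p
    obtain ⟨e, he⟩ := hder p p.2
    have hcd : ContDiffAt ℝ ∞ G₀ ((p : EuclideanSpace ℝ (Fin 2)), 0) := hG.contDiffAt (hΩ.mem_nhds (hsub ⟨p.2, mem_univ _⟩))
    have hstrict : HasStrictFDerivAt G₀ (e : _ →L[ℝ] _) ((p : EuclideanSpace ℝ (Fin 2)), 0) := hcd.hasStrictFDerivAt' he (by simp)
    set Ψ := hstrict.toOpenPartialHomeomorph G₀ with hΨ
    have hsrc : Ψ.source ∈ 𝓝 (((p : EuclideanSpace ℝ (Fin 2)), (0 : EuclideanSpace ℝ (Fin 2))) : (EuclideanSpace ℝ (Fin 2)) × (EuclideanSpace ℝ (Fin 2))) :=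
      Ψ.open_source.mem_nhds hstrict.mem_toOpenPartialHomeomorph_source
    refine ⟨ι ⁻¹' Ψ.source, hι.continuousAt.preimage_mem_nhds hsrc, fun a ha b hb hab => hιinj ?_⟩
    have hab' : Ψ (ι a) = Ψ (ι b) := hab
    exact Ψ.injOn ha hb hab'
  obtain ⟨η, hη, hinjη⟩ := exists_injOn_prod_ball hGc h0 hloc
  refine ⟨η, hη, ?_⟩
  rintro ⟨x, w⟩ ⟨hx, hw⟩ ⟨x', w'⟩ ⟨hx', hw'⟩ h
  have key := @hinjη (⟨x, hx⟩, w) ⟨mem_univ _, hw⟩ (⟨x', hx'⟩, w') ⟨mem_univ _, hw'⟩ h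
  simp only [Prod.mk.injEq, Subtype.mk.injEq] at key
  exact Prod.ext key.1 key.2

/-- **Invertible differential on a thin tube** (invertibility is open, tube lemma). [folklore] -/
theorem exists_fderiv_equiv_tube {G₀ : (EuclideanSpace ℝ (Fin 2)) × (EuclideanSpace ℝ (Fin 2)) → EuclideanSpace ℝ (Fin 4)}
    {Ω : Set ((EuclideanSpace ℝ (Fin 2)) × (EuclideanSpace ℝ (Fin 2)))} {R' : ℝ} (hΩ : IsOpen Ω)
    (hG : ContDiffOn ℝ ∞ G₀ Ω) (hsub : closedBall (0 : EuclideanSpace ℝ (Fin 2)) R' ×ˢ (univ : Set (EuclideanSpace ℝ (Fin 2))) ⊆ Ω)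
    (hder : ∀ x ∈ closedBall (0 : EuclideanSpace ℝ (Fin 2)) R', fderiv ℝ G₀ (x, 0) ∈
      range ((↑) : (((EuclideanSpace ℝ (Fin 2)) × (EuclideanSpace ℝ (Fin 2))) ≃L[ℝ] EuclideanSpace ℝ (Fin 4)) →
        ((EuclideanSpace ℝ (Fin 2)) × (EuclideanSpace ℝ (Fin 2))) →L[ℝ] EuclideanSpace ℝ (Fin 4))) :
    ∃ η > 0, ∀ x ∈ closedBall (0 : EuclideanSpace ℝ (Fin 2)) R', ∀ w : EuclideanSpace ℝ (Fin 2), ‖w‖ < η → fderiv ℝ G₀ (x, w) ∈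
      range ((↑) : (((EuclideanSpace ℝ (Fin 2)) × (EuclideanSpace ℝ (Fin 2))) ≃L[ℝ] EuclideanSpace ℝ (Fin 4)) →
        ((EuclideanSpace ℝ (Fin 2)) × (EuclideanSpace ℝ (Fin 2))) →L[ℝ] EuclideanSpace ℝ (Fin 4)) := by
  have hcont : ContinuousOn (fderiv ℝ G₀) Ω := hG.continuousOn_fderiv_of_isOpen hΩ (by simp)
  set S : Set (((EuclideanSpace ℝ (Fin 2)) × (EuclideanSpace ℝ (Fin 2))) →L[ℝ] EuclideanSpace ℝ (Fin 4)) :=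
    range ((↑) : (((EuclideanSpace ℝ (Fin 2)) × (EuclideanSpace ℝ (Fin 2))) ≃L[ℝ] EuclideanSpace ℝ (Fin 4)) →
        ((EuclideanSpace ℝ (Fin 2)) × (EuclideanSpace ℝ (Fin 2))) →L[ℝ] EuclideanSpace ℝ (Fin 4)) with hS
  have hSo : IsOpen S := ContinuousLinearEquiv.isOpen
  have hOo : IsOpen (Ω ∩ (fderiv ℝ G₀) ⁻¹' S) := hcont.isOpen_inter_preimage hΩ hSo
  have hsub0 : closedBall (0 : EuclideanSpace ℝ (Fin 2)) R' ×ˢ ({0} : Set (EuclideanSpace ℝ (Fin 2))) ⊆ Ω ∩ (fderiv ℝ G₀) ⁻¹' S := by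
    rintro ⟨x, w⟩ ⟨hx, hw⟩
    rw [mem_singleton_iff] at hw
    subst hw
    exact ⟨hsub ⟨hx, mem_univ _⟩, hder x hx⟩
  obtain ⟨U, V, -, hV, hU, h0V, hUV⟩ := generalized_tube_lemma (isCompact_closedBall _ _) isCompact_singleton hOo hsub0
  have h0mem : (0 : EuclideanSpace ℝ (Fin 2)) ∈ V := h0V (mem_singleton _)
  obtain ⟨η, hη, hball⟩ := Metric.isOpen_iff.1 hV 0 h0mem
  refine ⟨η, hη, fun x hx w hw => ?_⟩
  have hmem : (x, w) ∈ Ω ∩ (fderiv ℝ G₀) ⁻¹' S := hUV ⟨hU hx, hball (mem_ball_zero_iff.2 hw)⟩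
  exact hmem.2

/-- **A thin tube over a compact piece of a zero section off `D_k` stays off `D_k`.** [folklore] -/
theorem exists_notMem_tube {k : ℕ} {G₀ : (EuclideanSpace ℝ (Fin 2)) × (EuclideanSpace ℝ (Fin 2)) → EuclideanSpace ℝ (Fin 4)}
    {Ω : Set ((EuclideanSpace ℝ (Fin 2)) × (EuclideanSpace ℝ (Fin 2)))} {R' : ℝ} (hΩ : IsOpen Ω)
    (hG : ContinuousOn G₀ Ω) (hsub : closedBall (0 : EuclideanSpace ℝ (Fin 2)) R' ×ˢ (univ : Set (EuclideanSpace ℝ (Fin 2))) ⊆ Ω)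
    (h0 : ∀ x ∈ closedBall (0 : EuclideanSpace ℝ (Fin 2)) R', G₀ (x, 0) ∉ modelHandlebody k) :
    ∃ η > 0, ∀ x ∈ closedBall (0 : EuclideanSpace ℝ (Fin 2)) R', ∀ w : EuclideanSpace ℝ (Fin 2), ‖w‖ < η → G₀ (x, w) ∉ modelHandlebody k := by
  have hOo : IsOpen (Ω ∩ G₀ ⁻¹' (modelHandlebody k)ᶜ) := hG.isOpen_inter_preimage hΩ (isClosed_modelHandlebody k).isOpen_compl
  have hsub0 : closedBall (0 : EuclideanSpace ℝ (Fin 2)) R' ×ˢ ({0} : Set (EuclideanSpace ℝ (Fin 2))) ⊆ Ω ∩ G₀ ⁻¹' (modelHandlebody k)ᶜ := by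
    rintro ⟨x, w⟩ ⟨hx, hw⟩
    rw [mem_singleton_iff] at hw
    subst hw
    exact ⟨hsub ⟨hx, mem_univ _⟩, h0 x hx⟩
  obtain ⟨U, V, -, hV, hU, h0V, hUV⟩ := generalized_tube_lemma (isCompact_closedBall _ _) isCompact_singleton hOo hsub0
  have h0mem : (0 : EuclideanSpace ℝ (Fin 2)) ∈ V := h0V (mem_singleton _)
  obtain ⟨η, hη, hball⟩ := Metric.isOpen_iff.1 hV 0 h0mem
  refine ⟨η, hη, fun x hx w hw => ?_⟩
  have hmem : (x, w) ∈ Ω ∩ G₀ ⁻¹' (modelHandlebody k)ᶜ := hUV ⟨hU hx, hball (mem_ball_zero_iff.2 hw)⟩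
  exact hmem.2

/-- **A compact set off `D_k` has a level gap above `M_k` off the poles**: there is `s > 0` such that every
point of it with all hole terms `≥ 1/2` has `G_k > 1 + s` (Cantor's intersection theorem for the closed
bands `{hole ≥ 1/2} ∩ {G_k ≤ 1 + 1/(n+1)}`, whose intersection lies in `D_k`). [folklore] -/
theorem exists_level_gap {k : ℕ} {K : Set (EuclideanSpace ℝ (Fin 4))} (hK : IsCompact K)
    (hKD : ∀ y ∈ K, y ∉ modelHandlebody k) :
    ∃ s : ℝ, 0 < s ∧ ∀ y ∈ K, (∀ j, (1 : ℝ) / 2 ≤ holeTerm k j y) → 1 + s < levelFun k y := by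
  set C : ℕ → Set (EuclideanSpace ℝ (Fin 4)) := fun n =>
    {y | ∀ j : Fin k, (1 : ℝ) / 2 ≤ holeTerm k j y} ∩ levelFun k ⁻¹' Iic (1 + 1 / ((n : ℝ) + 1)) with hC
  have hCc : ∀ n, IsClosed (C n) := fun n =>
    (continuousOn_levelFun (by norm_num : (0 : ℝ) < 1 / 2)).preimage_isClosed_of_isClosed (isClosed_guard (1 / 2)) isClosed_Iic
  have hCanti : ∀ ⦃i j : ℕ⦄, i ≤ j → C i ⊇ C j := by
    intro i j hij y hy
    refine ⟨hy.1, ?_⟩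
    have h1 : (1 : ℝ) / ((j : ℝ) + 1) ≤ 1 / ((i : ℝ) + 1) :=
      one_div_le_one_div_of_le (by positivity) (by exact_mod_cast Nat.add_le_add_right hij 1)
    have h2 : levelFun k y ≤ 1 + 1 / ((j : ℝ) + 1) := hy.2
    show levelFun k y ≤ 1 + 1 / ((i : ℝ) + 1)
    linarith
  have hdir : Directed (· ⊇ ·) C := directed_of_isDirected_le hCanti
  have hint : K ∩ ⋂ n, C n = ∅ := by
    refine eq_empty_iff_forall_notMem.2 fun y ⟨hyK, hyC⟩ => hKD y hyK ?_
    rw [mem_iInter] at hyC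
    refine mem_modelHandlebody_of_half_le (hyC 0).1 (le_of_forall_pos_lt_add fun e he => ?_)
    obtain ⟨n, hn⟩ := exists_nat_one_div_lt he
    have h2 : levelFun k y ≤ 1 + 1 / ((n : ℝ) + 1) := (hyC n).2
    linarith
  obtain ⟨n, hn⟩ := hK.elim_directed_family_closed C hCc hint hdir
  refine ⟨1 / ((n : ℝ) + 1), by positivity, fun y hy hh => ?_⟩
  by_contra hle
  push Not at hle
  have : y ∈ K ∩ C n := ⟨hy, hh, mem_Iic.2 hle⟩
  rw [hn] at this
  exact this

/-! ## Calculus of the blend along the zero section -/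

/-- **The affine tube on a framing has differential `(v, a) ↦ dgₓ v + a₀ m₀ x + a₁ m₁ x` along the zero
section.** [folklore] -/
theorem hasFDerivAt_affineTube {g m₀ m₁ : EuclideanSpace ℝ (Fin 2) → EuclideanSpace ℝ (Fin 4)} {x : EuclideanSpace ℝ (Fin 2)}
    (hg : DifferentiableAt ℝ g x) (hm₀ : DifferentiableAt ℝ m₀ x) (hm₁ : DifferentiableAt ℝ m₁ x) :
    HasFDerivAt (fun q : (EuclideanSpace ℝ (Fin 2)) × (EuclideanSpace ℝ (Fin 2)) => g q.1 + q.2 0 • m₀ q.1 + q.2 1 • m₁ q.1)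
      ((fderiv ℝ g x).comp (ContinuousLinearMap.fst ℝ (EuclideanSpace ℝ (Fin 2)) (EuclideanSpace ℝ (Fin 2))) +
        ((EuclideanSpace.proj (𝕜 := ℝ) (0 : Fin 2)).comp
          (ContinuousLinearMap.snd ℝ (EuclideanSpace ℝ (Fin 2)) (EuclideanSpace ℝ (Fin 2)))).smulRight (m₀ x) +
        ((EuclideanSpace.proj (𝕜 := ℝ) (1 : Fin 2)).comp
          (ContinuousLinearMap.snd ℝ (EuclideanSpace ℝ (Fin 2)) (EuclideanSpace ℝ (Fin 2)))).smulRight (m₁ x)) (x, 0) := by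
  have hg' : HasFDerivAt (fun q : (EuclideanSpace ℝ (Fin 2)) × (EuclideanSpace ℝ (Fin 2)) => g q.1)
      ((fderiv ℝ g x).comp (ContinuousLinearMap.fst ℝ (EuclideanSpace ℝ (Fin 2)) (EuclideanSpace ℝ (Fin 2)))) (x, 0) :=
    hg.hasFDerivAt.comp (x, 0) hasFDerivAt_fst
  have hterm : ∀ (i : Fin 2) (m : EuclideanSpace ℝ (Fin 2) → EuclideanSpace ℝ (Fin 4)), DifferentiableAt ℝ m x →
      HasFDerivAt (fun q : (EuclideanSpace ℝ (Fin 2)) × (EuclideanSpace ℝ (Fin 2)) => q.2 i • m q.1)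
        (((EuclideanSpace.proj (𝕜 := ℝ) i).comp
          (ContinuousLinearMap.snd ℝ (EuclideanSpace ℝ (Fin 2)) (EuclideanSpace ℝ (Fin 2)))).smulRight (m x)) (x, 0) := by
    intro i m hm
    have hc : HasFDerivAt (fun q : (EuclideanSpace ℝ (Fin 2)) × (EuclideanSpace ℝ (Fin 2)) => q.2 i)
        ((EuclideanSpace.proj (𝕜 := ℝ) i).comp
          (ContinuousLinearMap.snd ℝ (EuclideanSpace ℝ (Fin 2)) (EuclideanSpace ℝ (Fin 2)))) (x, 0) :=
      ((EuclideanSpace.proj (𝕜 := ℝ) i).hasFDerivAt).comp (x, 0) hasFDerivAt_snd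
    have hmd : HasFDerivAt (fun q : (EuclideanSpace ℝ (Fin 2)) × (EuclideanSpace ℝ (Fin 2)) => m q.1)
        ((fderiv ℝ m x).comp (ContinuousLinearMap.fst ℝ (EuclideanSpace ℝ (Fin 2)) (EuclideanSpace ℝ (Fin 2)))) (x, 0) :=
      hm.hasFDerivAt.comp (x, 0) hasFDerivAt_fst
    refine (hc.fun_smul hmd).congr_fderiv ?_
    simp
  exact (hg'.fun_add (hterm 0 m₀ hm₀)).fun_add (hterm 1 m₁ hm₁)

/-- **The differential of a blend `A + χ(x) • (C - A)` at a point of the zero section where `C = A`** is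
`dA + χ(x) • (dC - dA)` (the term `dχ ⊗ (C - A)` vanishes there). [folklore] -/
theorem hasFDerivAt_blend {A C : (EuclideanSpace ℝ (Fin 2)) × (EuclideanSpace ℝ (Fin 2)) → EuclideanSpace ℝ (Fin 4)} {χ : EuclideanSpace ℝ (Fin 2) → ℝ}
    {x : EuclideanSpace ℝ (Fin 2)} {LA LC : (EuclideanSpace ℝ (Fin 2)) × (EuclideanSpace ℝ (Fin 2)) →L[ℝ] EuclideanSpace ℝ (Fin 4)}
    {Lχ : (EuclideanSpace ℝ (Fin 2)) × (EuclideanSpace ℝ (Fin 2)) →L[ℝ] ℝ}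
    (hA : HasFDerivAt A LA (x, 0)) (hC : HasFDerivAt C LC (x, 0))
    (hχ : HasFDerivAt (fun q : (EuclideanSpace ℝ (Fin 2)) × (EuclideanSpace ℝ (Fin 2)) => χ q.1) Lχ (x, 0))
    (h0 : C (x, 0) = A (x, 0)) :
    HasFDerivAt (fun q : (EuclideanSpace ℝ (Fin 2)) × (EuclideanSpace ℝ (Fin 2)) => A q + χ q.1 • (C q - A q))
      (LA + χ x • (LC - LA)) (x, 0) := by
  have h := hA.fun_add (hχ.fun_smul (hC.fun_sub hA))
  have h' : LA + (χ ((x, (0 : EuclideanSpace ℝ (Fin 2))) : (EuclideanSpace ℝ (Fin 2)) × (EuclideanSpace ℝ (Fin 2))).1 • (LC - LA) + Lχ.smulRight (C (x, 0) - A (x, 0))) =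
      LA + χ x • (LC - LA) := by
    rw [h0, sub_self, ContinuousLinearMap.smulRight_zero, add_zero]
  rw [h'] at h
  exact h

/-- **Partial derivatives of a map on `ℝ² × ℝ²` along the two factors.** [folklore] -/
theorem fderiv_apply_prod_eq {C : (EuclideanSpace ℝ (Fin 2)) × (EuclideanSpace ℝ (Fin 2)) → EuclideanSpace ℝ (Fin 4)}
    {x w : EuclideanSpace ℝ (Fin 2)} (hC : DifferentiableAt ℝ C (x, w)) (v a : EuclideanSpace ℝ (Fin 2)) :
    fderiv ℝ C (x, w) (v, a) = fderiv ℝ (fun x' => C (x', w)) x v + fderiv ℝ (fun w' => C (x, w')) w a := by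
  rw [fderiv_comp_prodMk_left C hC, fderiv_comp_prodMk_right C hC, ← map_add]
  simp

/-- The fibre partial derivative is linear in the fibre vector: `∂_w C(x, ·)|_w a = a₀ c₀ + a₁ c₁` with
`cᵢ = ∂_w C(x, ·)|_w eᵢ`. [folklore] -/
theorem fderiv_fibre_decomp {C : (EuclideanSpace ℝ (Fin 2)) × (EuclideanSpace ℝ (Fin 2)) → EuclideanSpace ℝ (Fin 4)}
    (x w a : EuclideanSpace ℝ (Fin 2)) :
    fderiv ℝ (fun w' => C (x, w')) w a =
      a 0 • fderiv ℝ (fun w' => C (x, w')) w (EuclideanSpace.single 0 1) +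
        a 1 • fderiv ℝ (fun w' => C (x, w')) w (EuclideanSpace.single 1 1) := by
  conv_lhs => rw [euclideanSpace_two_decomp a]
  rw [map_add, map_smul, map_smul]

/-! ## Transversality of a frame to an immersed disc -/

/-- **Transversality in the form of the stub** (`dfₓ v + a n₀ + b n₁ = 0` only trivially) **is linear
independence of the four vectors `dfₓ e₀, dfₓ e₁, n₀, n₁`.** [folklore] -/
theorem transversal_iff_linearIndependent {L : EuclideanSpace ℝ (Fin 2) →L[ℝ] EuclideanSpace ℝ (Fin 4)} {p q : EuclideanSpace ℝ (Fin 4)} :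
    (∀ (v : EuclideanSpace ℝ (Fin 2)) (a b : ℝ), L v + a • p + b • q = 0 → v = 0 ∧ a = 0 ∧ b = 0) ↔
      LinearIndependent ℝ ![L (EuclideanSpace.single 0 1), L (EuclideanSpace.single 1 1), p, q] := by
  have key := transversal_iff_linearIndependent_four (L := L) ![p, q]
  simp only [Matrix.cons_val_zero, Matrix.cons_val_one] at key
  rw [← key]
  constructor
  · intro h v a hva
    rw [Fin.sum_univ_two] at hva
    simp only [Matrix.cons_val_zero, Matrix.cons_val_one] at hva
    obtain ⟨hv, ha, hb⟩ := h v (a 0) (a 1) (by rw [add_assoc]; exact hva)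
    refine ⟨hv, ?_⟩
    ext i
    fin_cases i
    · simpa using ha
    · simpa using hb
  · intro h v a b hv
    obtain ⟨hv0, ha⟩ := h v (!₂[a, b]) (by
      rw [Fin.sum_univ_two]
      simp only [Matrix.cons_val_zero, Matrix.cons_val_one]
      simpa [add_assoc] using hv)
    have ha0 := congrArg (fun z : EuclideanSpace ℝ (Fin 2) => z 0) ha
    have ha1 := congrArg (fun z : EuclideanSpace ℝ (Fin 2) => z 1) ha
    simp at ha0 ha1
    exact ⟨hv0, ha0, ha1⟩

/-- **Transversality survives precomposition with a linear injection** (the reparametrised disc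
`g = f ∘ R` has `dg = df ∘ dR`). [folklore] -/
theorem transversal_comp {L : EuclideanSpace ℝ (Fin 2) →L[ℝ] EuclideanSpace ℝ (Fin 4)} {M : EuclideanSpace ℝ (Fin 2) →L[ℝ] EuclideanSpace ℝ (Fin 2)}
    {p q : EuclideanSpace ℝ (Fin 4)} (hM : Injective M)
    (h : ∀ (v : EuclideanSpace ℝ (Fin 2)) (a b : ℝ), L v + a • p + b • q = 0 → v = 0 ∧ a = 0 ∧ b = 0) :
    ∀ (v : EuclideanSpace ℝ (Fin 2)) (a b : ℝ), (L.comp M) v + a • p + b • q = 0 → v = 0 ∧ a = 0 ∧ b = 0 := by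
  intro v a b hv
  obtain ⟨hMv, ha, hb⟩ := h (M v) a b hv
  exact ⟨(injective_iff_map_eq_zero _).1 hM v hMv, ha, hb⟩

/-- **A transversal frame makes the zero-section differential `(v, a) ↦ dgₓ v + a₀ p + a₁ q` a linear
isomorphism `ℝ² × ℝ² ≃ ℝ⁴`.** [folklore] -/
theorem exists_equiv_of_transversal {L : EuclideanSpace ℝ (Fin 2) →L[ℝ] EuclideanSpace ℝ (Fin 4)} {p q : EuclideanSpace ℝ (Fin 4)}
    (h : ∀ (v : EuclideanSpace ℝ (Fin 2)) (a b : ℝ), L v + a • p + b • q = 0 → v = 0 ∧ a = 0 ∧ b = 0) :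
    ∃ e : ((EuclideanSpace ℝ (Fin 2)) × (EuclideanSpace ℝ (Fin 2))) ≃L[ℝ] EuclideanSpace ℝ (Fin 4),
      (e : _ →L[ℝ] _) = L.comp (ContinuousLinearMap.fst ℝ (EuclideanSpace ℝ (Fin 2)) (EuclideanSpace ℝ (Fin 2))) +
        ((EuclideanSpace.proj (𝕜 := ℝ) (0 : Fin 2)).comp
          (ContinuousLinearMap.snd ℝ (EuclideanSpace ℝ (Fin 2)) (EuclideanSpace ℝ (Fin 2)))).smulRight p +
        ((EuclideanSpace.proj (𝕜 := ℝ) (1 : Fin 2)).comp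
          (ContinuousLinearMap.snd ℝ (EuclideanSpace ℝ (Fin 2)) (EuclideanSpace ℝ (Fin 2)))).smulRight q := by
  set T := L.comp (ContinuousLinearMap.fst ℝ (EuclideanSpace ℝ (Fin 2)) (EuclideanSpace ℝ (Fin 2))) +
        ((EuclideanSpace.proj (𝕜 := ℝ) (0 : Fin 2)).comp
          (ContinuousLinearMap.snd ℝ (EuclideanSpace ℝ (Fin 2)) (EuclideanSpace ℝ (Fin 2)))).smulRight p +
        ((EuclideanSpace.proj (𝕜 := ℝ) (1 : Fin 2)).comp
          (ContinuousLinearMap.snd ℝ (EuclideanSpace ℝ (Fin 2)) (EuclideanSpace ℝ (Fin 2)))).smulRight q with hT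
  have hTapply : ∀ (v a : EuclideanSpace ℝ (Fin 2)), T (v, a) = L v + a 0 • p + a 1 • q := fun v a => by
    simp [hT]
  have hinj : Injective T := by
    refine (injective_iff_map_eq_zero _).2 ?_
    rintro ⟨v, a⟩ hva
    rw [hTapply] at hva
    obtain ⟨hv, ha, hb⟩ := h v (a 0) (a 1) hva
    have ha0 : a = 0 := by
      ext i; fin_cases i
      · simpa using ha
      · simpa using hb
    rw [hv, ha0, Prod.mk_zero_zero]
  have hfin : Module.finrank ℝ ((EuclideanSpace ℝ (Fin 2)) × (EuclideanSpace ℝ (Fin 2))) = Module.finrank ℝ (EuclideanSpace ℝ (Fin 4)) := by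
    simp [Module.finrank_prod]
  have hbij : Bijective T := ⟨hinj, (LinearMap.injective_iff_surjective_of_finrank_eq_finrank hfin).1 hinj⟩
  refine ⟨(LinearEquiv.ofBijective (T : ((EuclideanSpace ℝ (Fin 2)) × (EuclideanSpace ℝ (Fin 2))) →ₗ[ℝ] EuclideanSpace ℝ (Fin 4)) hbij).toContinuousLinearEquiv, ?_⟩
  exact ContinuousLinearMap.ext fun _ => rfl

end FriendsCarrierVk

open FriendsCarrierVk in
/-- **Helper `helper_friendsCarrier_Vk_partB_tubeLemmas`** (piece of the registered stub
`helper_friendsCarrier_Vk_partB`: the level gap of a compact set off `D_k`).  A compact subset of `ℝ⁴`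
disjoint from the model handlebody `D_k` keeps a definite level gap `G_k > 1 + s` above `M_k` at its
points off the poles (all hole terms `≥ 1/2`) — so it misses the thin collar shell `Φ((0, s) × M_k)`.
[folklore] -/
theorem helper_friendsCarrier_Vk_partB_tubeLemmas : ∀ (k : ℕ) (K : Set (EuclideanSpace ℝ (Fin 4))), IsCompact K → (∀ y ∈ K, y ∉ modelHandlebody k) → ∃ s : ℝ, 0 < s ∧ ∀ y ∈ K, (∀ j, (1 : ℝ) / 2 ≤ holeTerm k j y) → 1 + s < levelFun k y :=
  fun _ _ hK hKD => exists_level_gap hK hKD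

end Summit.SmoothPoincare4.SmoothPoincare4.Theorems.DcrGap.MkFriends

end
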